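import Summits.BirchSwinnertonDyer.BirchSwinnertonDyer.Theorems.ClassRecordThreeCornerTwistWitnessKernel
import HarnessLib

/-!
# Route `KolyvaginRoadThree` (rung K2@3, sibling of `ClassRecordThree`): the `closes` kernel WITHOUT the
# Schneider binder `SchneiderTamAtThree` — D-0145 ideator seat bsd-idea-4 gen 7, helper #3 of the
# SWAP-19106 analysis (`--supports stmt-BirchSwinnertonDyer-19106 --as helper`: 19106 `SchneiderAtThree` and
# KR3's 19154 `SchneiderTamAtThree` are the same Schneider-at-3 bit, 19154 restricted to the Tamagawa cells)

HELPER. BSD is not proved; the leaf stays CONDITIONAL on every binder. Companion of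
`Theorems/ClassRecordThreeSchneiderFreeKernelUpperB.lean` (p631621). What IS proved (sorry-free):
`SchneiderFreeSwap.multiplicativeRankOneAtThree_of_kolyRecord_bdpRoadOnTam_upperB_of_twistWitness` —
`Theorems.multiplicativeRankOneAtThree_of_kolyRecord_upperB_of_twistWitness` (the kernel KR3's `closes`
runs through) with road (a) — `hReg` (= crux 19154) and its five published facts — DELETED, and road (b)
(`hDb`/`hHb`/`hUβ`/`hUγ`) stated on the WHOLE Tamagawa cell (ram) ∧ 3 ∣ ∏c, split(3) or not; A1 (the
Kolyvagin road `hA1`), road (d) and the twist-witness corner verbatim.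
USE (memo `pub/ideators/bsd-idea-4/lines/g7/SWAP-19106-memo.md` §7, sketch `KR3SwapGlue.lean`, farm-checked
rc 0 / 0 sorry): KR3's `closes` (rev 32) with `h₂ : SchneiderTamAtThree` deleted elaborates through this
kernel after widening exactly two items (20263 `IMCDivTwoLociTamAtThreeR` clause 1, shared 19109
`EulerHalvesAtThree` (γ∖α) clause: split(3) dropped), every other binder verbatim. Nothing booked; no route
opened or edited here (that is the pen's `route edit --closes-file`).
[cite: Castella2018, Thm. A (arXiv:1704.06608 p. 3) (uniform in a_p = ±1; hypothesis at p ∣ N = (ram))]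
[cite: Hsieh2014, Thm. 1 (arXiv:1112.1580 pp. 3–4)] [cite: MatarNekovar2019, Thm. 0.3 (p. 456)]
-/

noncomputable section

open scoped Classical

open WeierstrassCurve NumberField IsDedekindDomain Field Literature.NumberTheory.EllipticCurves
  Rat.HeightOneSpectrum
  Literature.NumberTheory.DiophantineGeometry
  Literature.NumberTheory.EllipticCurves.GreenbergSelmer
  Literature.NumberTheory.EllipticCurves.ModularForms
  Literature.NumberTheory.EllipticCurves.Rank1Residual
  Literature.NumberTheory.EllipticCurves.Rank1Residual.Typed
  Literature.NumberTheory.EllipticCurves.Wuthrich2014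
  Literature.NumberTheory.EllipticCurves.BalakrishnanEtAl2019
  Literature.NumberTheory.EllipticCurves.Skinner2016
  Literature.NumberTheory.EllipticCurves.SteinWuthrich2013
  Literature.NumberTheory.EllipticCurves.Disegni2020
  Literature.NumberTheory.EllipticCurves.BarriosEtAl2025
  Literature.NumberTheory.QuadraticFields.Quadratic
  Literature.NumberTheory.Automorphic
  Literature.NumberTheory.GaloisRepresentations Literature.NumberTheory.GaloisCohomology
  Summit.BirchSwinnertonDyer.Rank1Residual.X11b.AcSelmer
  Summit.BirchSwinnertonDyer.Rank1Residual.X11b.LocBridge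
  Summit.BirchSwinnertonDyer.Rank1Residual
  Summit.BirchSwinnertonDyer.Rank1Residual.X11b
  Summit.BirchSwinnertonDyer.Rank1Residual.X11b.Three

set_option linter.dupNamespace false

namespace Summit.BirchSwinnertonDyer.BirchSwinnertonDyer.Theorems.SchneiderFreeSwap

/-- **p2@3 `closes` kernel, Schneider-FREE twin** of `multiplicativeRankOneAtThree_of_kolyRecord_upperB_of_twistWitness`:
road (a) deleted; road (b) on the whole Tamagawa cell (ram) ∧ 3 ∣ ∏c. -/
theorem multiplicativeRankOneAtThree_of_kolyRecord_bdpRoadOnTam_upperB_of_twistWitness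
    (hGZ : ∀ (N : ℕ) [NeZero N] (W : WeierstrassCurve ℚ) (K : Type) [Field K] [NumberField K],
      gross_zagier N W K)
    (hKo : ∀ (N : ℕ) [NeZero N] (W : WeierstrassCurve ℚ) (K : Type) [Field K] [NumberField K],
      kolyvagin N W K)
    (hB : ∀ (N : ℕ) [NeZero N] (W : WeierstrassCurve ℚ) (K : Type) [Field K] [NumberField K],
      Kolyvagin1990_padicValNat_card_sha_le N W K)
    (hSk : Skinner2016.thmC_padicValRat_bsd_rank_zero) (hWu : sha_dvd_analyticSha)
    (hGZK : rank_eq_analyticRank_of_analyticRank_le_one) (hmod : hasEntireLFunction_rat)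
    (hnf : exists_isNewformOf) (hHL : HoffsteinLuo1997_exists_twist_L_one_ne_zero)
    (hMaz : mazur_not_dvd_maninConstant_of_odd)
    (hPT : ∀ (K : Type) [Field K] [NumberField K], poitouTate_sum_localTatePairing_eq_zero K)
    (hMN : ∀ (N : ℕ) [NeZero N] (W : WeierstrassCurve ℚ) (K : Type) [Field K] [NumberField K],
      MatarNekovar2019.thm03_padicValNat_card_sha_le_of_irreducible N W K)
    (hH : hsieh2014_exists_anticyclotomicPAdicLFunction)
    (hA1 : ∀ (W : WeierstrassCurve ℚ) [W.IsElliptic] [W.IsGloballyMinimal],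
      ClassX11b W 3 → Ram W 3 → ¬ 3 ∣ W.tamagawaProduct → BSDp W 3)
    (hDb : ∀ (W : WeierstrassCurve ℚ) [W.IsElliptic] [W.IsGloballyMinimal],
      ClassX11b W 3 → Ram W 3 → 3 ∣ W.tamagawaProduct → HsiehDescentAt₃ W)
    (hHb : ∀ (W : WeierstrassCurve ℚ) [W.IsElliptic] [W.IsGloballyMinimal],
      ClassX11b W 3 → Ram W 3 → 3 ∣ W.tamagawaProduct → BDPValueAt₃ W ∧ IMCDivAt₃B W)
    (hUβ : ∀ (W : WeierstrassCurve ℚ) [W.IsElliptic] [W.IsGloballyMinimal],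
      ClassX11b W 3 → Ram W 3 → ¬ ShapeAlpha W → ¬ ShapeGamma W → 3 ∣ W.tamagawaProduct →
        Typed.MissingUpperBoundAt W 3)
    (hUα : ∀ (W : WeierstrassCurve ℚ) [W.IsElliptic] [W.IsGloballyMinimal],
      ClassX11b W 3 → Ram W 3 → ShapeAlpha W → Typed.MissingUpperBoundAt W 3)
    (hUγ : ∀ (W : WeierstrassCurve ℚ) [W.IsElliptic] [W.IsGloballyMinimal],
      ClassX11b W 3 → Ram W 3 → ¬ ShapeAlpha W → ShapeGamma W → Typed.MissingUpperBoundAt W 3)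
    (hDd : ∀ (W : WeierstrassCurve ℚ) [W.IsElliptic] [W.IsGloballyMinimal],
      ClassX11b W 3 → ¬ Ram W 3 → Surj W 3 → HsiehDescentAt₃ W)
    (hHd : ∀ (W : WeierstrassCurve ℚ) [W.IsElliptic] [W.IsGloballyMinimal],
      ClassX11b W 3 → ¬ Ram W 3 → Surj W 3 → BDPValueAt₃ W ∧ IMCDivAt₃B W)
    (hU₀ : ∀ (W : WeierstrassCurve ℚ) [W.IsElliptic] [W.IsGloballyMinimal],
      ClassX11b W 3 → Surj W 3 → ¬ Ram W 3 → Typed.MissingUpperBoundAt W 3)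
    (hCL : ∀ (W : WeierstrassCurve ℚ) [W.IsElliptic] [W.IsGloballyMinimal], CornerStepLAt W)
    (hCW : ∀ (W : WeierstrassCurve ℚ) [W.IsElliptic] [W.IsGloballyMinimal],
      CornerTwistWitness.CornerTwistWitnessAt W)
    (hCU : ∀ (W : WeierstrassCurve ℚ) [W.IsElliptic] [W.IsGloballyMinimal], CornerUpperAt W) :
    MultiplicativeRankOneAtThree := by
  intro W _ _ hX
  have hEP : ∀ (K : Type) [Field K] [NumberField K] (v : HeightOneSpectrum (𝓞 K)),
      localEulerPoincareCharacteristic (v.adicCompletion K) :=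
    GaloisImage.EP.localEulerPoincareCharacteristic_adicCompletion
  by_cases hram : Ram W 3
  · by_cases htam : 3 ∣ W.tamagawaProduct
    · -- road (b′) on the WHOLE Tamagawa cell (split or not): StepLAt W from descent + H2 ∧ H3ᴮ
      have hL : StepLAt W :=
        stepLAt_of_halves₃_of_classX11bB hnf hKo hPT hEP hX
          (bdpExistsAt₃_of_hsieh2014_of_descent W hH lambdaSupplyAt₃ (hDb W hX hram htam))
          (hHb W hX hram htam).1 (hHb W hX hram htam).2
      exact Three.bsdp_three_of_surj_of_stepLAt_of_shapes_upper hGZ hKo hB hSk hWu hGZK hmod hnf hHL hMaz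
        hPT hEP W hX (surj_of_irr_of_ram W 3 hX.2.2.2 hram) hL
        (fun hram hα hγ ht ↦ hUβ W hX hram hα hγ ht) (fun hram hα ↦ hUα W hX hram hα)
        (fun hram hα hγ ↦ hUγ W hX hram hα hγ) (fun h ↦ absurd hram h)
    · -- A1: the Kolyvagin road decides
      exact hA1 W hX hram htam
  · by_cases hsurj : Surj W 3
    · -- road (d), verbatim
      have hL₀ : StepLAt W :=
        stepLAt_of_halves₃_of_classX11bB hnf hKo hPT hEP hX
          (bdpExistsAt₃_of_hsieh2014_of_descent W hH lambdaSupplyAt₃ (hDd W hX hram hsurj))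
          (hHd W hX hram hsurj).1 (hHd W hX hram hsurj).2
      exact Three.bsdp_three_of_surj_of_stepLAt_of_shapes_upper hGZ hKo hB hSk hWu hGZK hmod hnf hHL hMaz
        hPT hEP W hX hsurj hL₀ (fun h _ _ _ ↦ absurd h hram) (fun h _ ↦ absurd h hram)
        (fun h _ _ ↦ absurd h hram) (fun _ ↦ hU₀ W hX hsurj hram)
    · -- the corner, verbatim
      refine Typed.bsdp_of_missingPPartAt W 3 hGZK (by rw [hX.1]) ?_
      exact CornerTwistWitness.missingPPartAt_of_corner_of_witness hGZ hKo hGZK hmod hnf hMaz hPT hEP hMN W hX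
        hsurj (hCL W) (hCW W) (fun ht ↦
          CornerTwistWitness.missingUpperBoundAt_of_cornerUpperAt_of_cornerTwistWitnessAt hGZ hKo hGZK hmod hnf
            hMaz W hX hsurj ht (hCU W) (hCW W))

end Summit.BirchSwinnertonDyer.BirchSwinnertonDyer.Theorems.SchneiderFreeSwap


end
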